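import Literature.IUT.HodgeTheaters.TemperedCoveringsProp2122SubAt
import Literature.IUT.HodgeTheaters.TemperedCoveringsByNameAtCountable
import Literature.IUT.HodgeTheaters.StableCurveTemperedDataOfSpecialFibre
import Literature.AnabelianGeometry.SemiGraphs.TemperedCompactInVerticialFinite
import Literature.AnabelianGeometry.SemiGraphs.TemperedVerticialNamedFactsProofs
import Literature.AnabelianGeometry.SemiGraphs.TemperedGaloisDomination
import Literature.AnabelianGeometry.SemiGraphs.TemperedCompactPreimage
import HarnessLib

/-!
# [IUTchI] Prop. 2.1 / Prop. 2.2 / Rmk. 2.2.2 AT THE GENUINE 𝔛-DATUM `StableCurveTemperedData.ofSpecialFibre`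
# with FINITE special-fibre semi-graph: no [SemiAnbd] §3 hypothesis, no `hCV`

Mochizuki, *Inter-universal Teichmüller theory I*, kurims manuscript (May 2020), §2, Prop. 2.1 "Profinite
Conjugates of Nontrivial Compact Subgroups" p. 45, Prop. 2.2 "Commensurators of Decomposition Subgroups …"
pp. 45–46, Rmk. 2.2.2 p. 46 [cite: Mochizuki2012, Prop 2.1 p.45; Prop 2.2 pp.45-46; Rmk 2.2.2 p.46] (D-0012 claim
key; series status DISPUTED; nothing of the series is asserted here), over [SemiAnbd] Thm. 3.7 (i)/(iii)
pp. 40–41 and Ex. 3.10 pp. 43–45 [cite: MochizukiSemiAnbd2006, Thm 3.7 pp.40-41; Ex 3.10 pp.43-45].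

PROOF-ONLY companion (abc-iut cell, F fact-proving wave, seat abc-iut-f-192, tranche 192: FROZEN FACT-LIST rows
**F-2589** `TemperedGraphGroupData.ProfiniteConjugatesOfCompactSubgroups`, **F-2590**
`….CommensuratorsOfDecompositionSubgroups`, **F-2591** `….TemperedNormallyTerminal` — R5 SCHEMAS whose universal
closures are refuted in `FactListL5TemperedSchemas.lean`; this file lands their INSTANCE FORMS at the consumer's
datum).  No definition, no new `Prop` fact; no statement file is edited or restated.

THE DATUM.  The cone's consumer of the three rows is the genuine [IUTchI] §2 𝔛-datum
`𝔇 := StableCurveTemperedData.ofSpecialFibre X d S h36 Σ Σ̂ hsub hne hprime hp TpH HatH hle cuspMeetsH`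
(abc-iut-L5-t11) of a tempered curve `X : TemperedCurve p` with parameter bundle `d` and special-fibre data `S`
([SemiAnbd] Ex. 3.10: the semi-graph of anabelioids with compact structure `S.Gc` of the geometric special
fibre, `Thm37Hypotheses` = `S.hyp`, an arbitrary chart `S.chart` of `π₁^temp(G^c)`), whose 𝔾-data is `ofChart`
(`Π^tp_𝔾 := S.chart.G`, `Π̂_𝔾 :=` the chosen profinite completion) — the datum at which the layer-5 certificate
`Summits/ABC/IUTFork/Conditional/Layer5OfS.lean` (`layer5_held_sec2`) binds Prop. 2.2 as the hypothesis `h22`.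

WHAT IS PROVED (one-line compositions of the per-graph kernels `…_at` / `…_at'` of
`TemperedCoveringsChartsAt` / `…ByNameAtCountable` / `…NodNonAt` / `…Prop2122SubAt` — the same pattern as
abc-iut-L3-d1's `TemperedCoveringsFiniteGraph.lean` (p431878), taken here at the 𝔛-datum — in which [SemiAnbd]
Thm. 3.7 (iii) is abc-iut-L3-t8's `compactInVerticialAt_of_finiteGraph`, Thm. 3.7 (i) is
`verticialInjective_holds` and Galois domination is `galoisDomination_of_prop36 h36`, with the structural
inputs of the datum supplied BY NAME: chart `c := S.chart`, identification `e := ContinuousMulEquiv.refl`,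
`h𝒢 := S.hyp`, `hPC := TemperedGraphGroupData.ofChart_isProfiniteCompletion`), for a special fibre whose
underlying semi-graph is FINITE (`[Finite S.Gc.graph.Vertex] [Finite S.Gc.graph.Edge]` — the dual
semi-graph of a pointed stable curve is finite; the interface `SpecialFibreData` does not record it, so it
is an explicit side condition here):
* `graph_prop21_ofSpecialFibre_of_finiteGraph` — **F-2589 instance** `𝔇.graph.ProfiniteConjugatesOfCompactSubgroups`
  modulo ONLY a verticial family `Λv` (one exists: `exists_verticialFamily_of_prop36`) and node data
  `src tgt c₁ c₂` with the adjacency alternative (A3);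
* `graph_tp_isCommensurablyTerminal_ofSpecialFibre_of_finiteGraph` — the clause `tp_in_hat` of F-2590
  ("in particular `Π^tp_𝔾` is commensurably terminal in `Π̂_𝔾`") modulo the same;
* `graph_temperedNormallyTerminal_ofSpecialFibre_of_finiteGraph` — **F-2591 instance**
  `𝔇.graph.TemperedNormallyTerminal` modulo the same;
* the BY-NAME forms over a `PSCDatum` on `Π̂_𝔾` in which (A3) is the FROZEN FACT-LIST row F-2540
  `PSCDatum.VerticialIntersectionNear` ([NodNon] Lem. 1.9 (ii)) consumed BY NAME:
  `graph_prop21_byName_ofSpecialFibre_of_finiteGraph`, `graph_prop22_inParticular_byName_ofSpecialFibre_of_finiteGraph`,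
  `graph_temperedNormallyTerminal_byName_ofSpecialFibre_of_finiteGraph`;
* `graph_prop22_byName_ofSpecialFibre_of_finiteGraph` — **F-2590 instance AS TYPED** (all four clauses of
  `CommensuratorsOfDecompositionSubgroups`, i.e. the certificate's binder `h22` itself) modulo the BY-NAME
  inputs for `𝔾` AND for the `ℍ`-datum `𝔇.graph.restrictH hcH` (a chart of a finite `𝒢H` satisfying
  `Thm37Hypotheses`, its `IsProfiniteCompletion`, a `PSCDatum` with F-2540, node data) and the cited
  `hHatH` ([SemiAnbd] Cor. 2.7 (i), pro-`Σ̂` form; kernel route: abc-iut-w4-d071's `hatH_commTerminal`).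
HONEST RESIDUAL: node data with (A3) / F-2540 and, for Prop. 2.2 as typed, the `ℍ`-side chart data + `hHatH`;
NO `CompactInVerticialAt` / `VerticialInjective` / Galois-domination binder remains.  Typed ≠ proved for the
[IUTchI] nodes at infinite graphs; a FACT row is an assumption label; no side taken on [IUTchIII] Cor. 3.12.
-/

noncomputable section

namespace Literature.IUT.HodgeTheaters

open Pointwise
open _root_.Topology
open Literature.AnabelianGeometry.SemiGraphs (IsTempered IsProfiniteCompletion PSCDatum ProfiniteSemiGraph
  SpecialFibreData TemperedCurve)
open Literature.AnabelianGeometry.SemiGraphs.ProfiniteSemiGraph (TemperedPiChart verticialSubgroups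
  compactInVerticialAt_of_finiteGraph verticialInjective_holds galoisDomination_of_prop36)
open Literature.AnabelianGeometry.AbsoluteAnabelian (IsCommensurablyTerminal)

namespace StableCurveTemperedData

variable {p : ℕ} [Fact p.Prime] (X : TemperedCurve p) (d : X.GroupLevelData)
  (S : SpecialFibreData (X.toTemperedArithmeticGroup d)) (h36 : S.Gc.Prop36Hypotheses)
  (Sigma SigmaHat : Set ℕ) (hsub : Sigma ⊆ SigmaHat) (hne : Sigma.Nonempty)
  (hprime : ∀ q ∈ SigmaHat, q.Prime) (hp : p ∉ Sigma)
  (TpH : Subgroup S.chart.G)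
  (HatH : Subgroup (TemperedGraphGroupData.exists_completion_of_prop36 S.Gc h36 S.chart).choose)
  (hle : TpH.map (TemperedGraphGroupData.exists_completion_of_prop36 S.Gc h36
    S.chart).choose_spec.choose.toMonoidHom ≤ HatH)
  (cuspMeetsH : {x : X.Pt // X.IsCusp x} → Prop)

/-! ### The structural inputs of the datum BY NAME: `e := refl`, `hPC`, `[T2Space Π^tp_𝔾]` -/

/-- The identification `e : Π^tp_𝔾 ≃ₜ* S.chart.G` of the datum is the identity (`Π^tp_𝔾 := S.chart.G`
definitionally, `ofSpecialFibre_graph_Tp`): mapping a subgroup along it does nothing — the `e := refl`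
instance of the binder shape `(Λv v).map (e : D.Tp →* c.G) ∈ verticialSubgroups c v`.
[cite: MochizukiSemiAnbd2006, Thm 3.7(i) p.40] -/
theorem ofSpecialFibre_graph_map_refl
    (H : Subgroup (ofSpecialFibre X d S h36 Sigma SigmaHat hsub hne hprime hp TpH HatH hle cuspMeetsH).graph.Tp) :
    H.map ((@id ((ofSpecialFibre X d S h36 Sigma SigmaHat hsub hne hprime hp TpH HatH hle cuspMeetsH).graph.Tp ≃ₜ*
          S.chart.G) (ContinuousMulEquiv.refl _)) :
      (ofSpecialFibre X d S h36 Sigma SigmaHat hsub hne hprime hp TpH HatH hle cuspMeetsH).graph.Tp →*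
        S.chart.G) = H := by
  ext x
  constructor
  · rintro ⟨y, hy, rfl⟩
    exact hy
  · intro hx
    exact ⟨x, hx, rfl⟩

/-- **`hPC` BY NAME at the datum**: the completion map `Π^tp_𝔾 → Π̂_𝔾` of `𝔇.graph = ofChart S.Gc h36 S.chart …`
satisfies `IsProfiniteCompletion` ([SemiAnbd] Prop. 3.6 (iii); abc-iut-L5-t11's `ofChart_isProfiniteCompletion`).
[cite: MochizukiSemiAnbd2006, Prop 3.6(iii) p.38] -/
theorem ofSpecialFibre_graph_isProfiniteCompletion :
    IsProfiniteCompletion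
      ({ toMonoidHom :=
           (ofSpecialFibre X d S h36 Sigma SigmaHat hsub hne hprime hp TpH HatH hle cuspMeetsH).graph.ι,
         continuous_toFun :=
           (ofSpecialFibre X d S h36 Sigma SigmaHat hsub hne hprime hp TpH HatH hle
             cuspMeetsH).graph.ι_continuous } :
        (ofSpecialFibre X d S h36 Sigma SigmaHat hsub hne hprime hp TpH HatH hle cuspMeetsH).graph.Tp →ₜ*
          (ofSpecialFibre X d S h36 Sigma SigmaHat hsub hne hprime hp TpH HatH hle cuspMeetsH).graph.Hat) :=
  TemperedGraphGroupData.ofChart_isProfiniteCompletion S.Gc h36 S.chart Sigma SigmaHat hsub hne hprime TpH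
    HatH hle

/-- `Π^tp_𝔾 = π₁^temp(G^c)` of the datum is Hausdorff (a tempered group: `S.chart.isTempered`).
[cite: MochizukiSemiAnbd2006, Prop 3.6(i) p.38] -/
theorem ofSpecialFibre_graph_t2Space :
    T2Space (ofSpecialFibre X d S h36 Sigma SigmaHat hsub hne hprime hp TpH HatH hle cuspMeetsH).graph.Tp :=
  S.chart.isTempered.t2Space

/-! ### F-2589 / F-2590 (`tp_in_hat`) / F-2591 at the datum, node data with (A3) -/

section NodeData

variable (Λv : S.Gc.graph.Vertex →
    Subgroup (ofSpecialFibre X d S h36 Sigma SigmaHat hsub hne hprime hp TpH HatH hle cuspMeetsH).graph.Tp)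
  (hΛv : ∀ v, Λv v ∈ verticialSubgroups S.chart v)
  {E : Type*} (src tgt : E → S.Gc.graph.Vertex)
  (c₁ c₂ : E → (ofSpecialFibre X d S h36 Sigma SigmaHat hsub hne hprime hp TpH HatH hle cuspMeetsH).graph.Tp)
  (hA3 : ∀ (v w : S.Gc.graph.Vertex)
      (g h : (ofSpecialFibre X d S h36 Sigma SigmaHat hsub hne hprime hp TpH HatH hle cuspMeetsH).graph.Hat),
      MulAut.conj g •
            (Λv v).map (ofSpecialFibre X d S h36 Sigma SigmaHat hsub hne hprime hp TpH HatH hle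
              cuspMeetsH).graph.ι ⊓
          MulAut.conj h •
            (Λv w).map (ofSpecialFibre X d S h36 Sigma SigmaHat hsub hne hprime hp TpH HatH hle
              cuspMeetsH).graph.ι ≠ ⊥ →
        (v = w ∧ g⁻¹ * h ∈ (Λv v).map (ofSpecialFibre X d S h36 Sigma SigmaHat hsub hne hprime hp TpH HatH
          hle cuspMeetsH).graph.ι) ∨
        ∃ (e : E) (k : (ofSpecialFibre X d S h36 Sigma SigmaHat hsub hne hprime hp TpH HatH hle
            cuspMeetsH).graph.Hat),
          ∃ r ∈ (Λv (src e)).map (ofSpecialFibre X d S h36 Sigma SigmaHat hsub hne hprime hp TpH HatH hle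
              cuspMeetsH).graph.ι,
          ∃ q ∈ (Λv (tgt e)).map (ofSpecialFibre X d S h36 Sigma SigmaHat hsub hne hprime hp TpH HatH hle
              cuspMeetsH).graph.ι,
            (src e = v ∧ tgt e = w ∧
                g = k * (ofSpecialFibre X d S h36 Sigma SigmaHat hsub hne hprime hp TpH HatH hle
                  cuspMeetsH).graph.ι (c₁ e) * r ∧
                h = k * (ofSpecialFibre X d S h36 Sigma SigmaHat hsub hne hprime hp TpH HatH hle
                  cuspMeetsH).graph.ι (c₂ e) * q) ∨
            (src e = w ∧ tgt e = v ∧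
                h = k * (ofSpecialFibre X d S h36 Sigma SigmaHat hsub hne hprime hp TpH HatH hle
                  cuspMeetsH).graph.ι (c₁ e) * r ∧
                g = k * (ofSpecialFibre X d S h36 Sigma SigmaHat hsub hne hprime hp TpH HatH hle
                  cuspMeetsH).graph.ι (c₂ e) * q))

include hΛv hA3 in
/-- **F-2589 INSTANCE — [IUTchI] Prop. 2.1 AS TYPED at the genuine 𝔛-datum with finite special fibre**:
`𝔇.graph.ProfiniteConjugatesOfCompactSubgroups` ("for every nontrivial compact `Λ ⊆ Π^tp_𝔾` and `γ ∈ Π̂_𝔾`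
with `γΛγ⁻¹ ⊆ Π^tp_𝔾`, `γ ∈ Π^tp_𝔾`"), every [SemiAnbd] §3 input a kernel theorem (`prop21_of_chart_of_isProfiniteCompletion_at'` with
`c := S.chart`, `e := refl`, `h𝒢 := S.hyp`, `hCV := compactInVerticialAt_of_finiteGraph`,
`hPC := ofChart_isProfiniteCompletion`); residual = a verticial family and node data with (A3).
([IUTchI] Prop 2.1 p.45) [cite: Mochizuki2012, Prop 2.1 p.45] [claim: Mochizuki2012, status: disputed] -/
theorem graph_prop21_ofSpecialFibre_of_finiteGraph [Finite S.Gc.graph.Vertex] [Finite S.Gc.graph.Edge] :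
    (ofSpecialFibre X d S h36 Sigma SigmaHat hsub hne hprime hp TpH HatH hle
      cuspMeetsH).graph.ProfiniteConjugatesOfCompactSubgroups :=
  (ofSpecialFibre X d S h36 Sigma SigmaHat hsub hne hprime hp TpH HatH hle
      cuspMeetsH).graph.prop21_of_chart_of_isProfiniteCompletion_at'
    S.chart
    (@id ((ofSpecialFibre X d S h36 Sigma SigmaHat hsub hne hprime hp TpH HatH hle cuspMeetsH).graph.Tp ≃ₜ*
      S.chart.G) (ContinuousMulEquiv.refl _)) S.hyp compactInVerticialAt_of_finiteGraph
    (ofSpecialFibre_graph_isProfiniteCompletion X d S h36 Sigma SigmaHat hsub hne hprime hp TpH HatH hle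
      cuspMeetsH)
    Λv
    (fun v => by
      rw [ofSpecialFibre_graph_map_refl X d S h36 Sigma SigmaHat hsub hne hprime hp TpH HatH hle cuspMeetsH]
      exact hΛv v)
    src tgt c₁ c₂ hA3

include hΛv hA3 in
/-- **F-2590, clause `tp_in_hat` — [IUTchI] Prop. 2.2 "in particular, `Π^tp_𝔾` is commensurably terminal in
`Π̂_𝔾`" at the genuine 𝔛-datum with finite special fibre**, every [SemiAnbd] §3 input a kernel theorem
(Thm. 3.7 (i) `verticialInjective_holds`, Thm. 3.7 (iii) `compactInVerticialAt_of_finiteGraph`); residual =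
a verticial family and node data with (A3). ([IUTchI] Prop 2.2 p.45) [cite: Mochizuki2012, Prop 2.2 p.45]
[claim: Mochizuki2012, status: disputed] -/
theorem graph_tp_isCommensurablyTerminal_ofSpecialFibre_of_finiteGraph [Finite S.Gc.graph.Vertex]
    [Finite S.Gc.graph.Edge] :
    IsCommensurablyTerminal
      (ofSpecialFibre X d S h36 Sigma SigmaHat hsub hne hprime hp TpH HatH hle cuspMeetsH).graph.ι.range :=
  (ofSpecialFibre X d S h36 Sigma SigmaHat hsub hne hprime hp TpH HatH hle
      cuspMeetsH).graph.tp_isCommensurablyTerminal_of_chart_of_isProfiniteCompletion_at'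
    S.chart
    (@id ((ofSpecialFibre X d S h36 Sigma SigmaHat hsub hne hprime hp TpH HatH hle cuspMeetsH).graph.Tp ≃ₜ*
      S.chart.G) (ContinuousMulEquiv.refl _)) S.hyp compactInVerticialAt_of_finiteGraph verticialInjective_holds
    (ofSpecialFibre_graph_isProfiniteCompletion X d S h36 Sigma SigmaHat hsub hne hprime hp TpH HatH hle
      cuspMeetsH)
    Λv
    (fun v => by
      rw [ofSpecialFibre_graph_map_refl X d S h36 Sigma SigmaHat hsub hne hprime hp TpH HatH hle cuspMeetsH]
      exact hΛv v)
    src tgt c₁ c₂ hA3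

include hΛv hA3 in
/-- **F-2591 INSTANCE — [IUTchI] Rmk. 2.2.2: `Π^tp_𝔾` is NORMALLY terminal in `Π̂_𝔾`** (`𝔇.graph.TemperedNormallyTerminal`)
at the genuine 𝔛-datum with finite special fibre, every [SemiAnbd] §3 input a kernel theorem; residual = a
verticial family and node data with (A3). ([IUTchI] Rmk 2.2.2 p.46) [cite: Mochizuki2012, Rmk 2.2.2 p.46]
[claim: Mochizuki2012, status: disputed] -/
theorem graph_temperedNormallyTerminal_ofSpecialFibre_of_finiteGraph [Finite S.Gc.graph.Vertex]
    [Finite S.Gc.graph.Edge] :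
    (ofSpecialFibre X d S h36 Sigma SigmaHat hsub hne hprime hp TpH HatH hle
      cuspMeetsH).graph.TemperedNormallyTerminal :=
  (ofSpecialFibre X d S h36 Sigma SigmaHat hsub hne hprime hp TpH HatH hle
      cuspMeetsH).graph.temperedNormallyTerminal_of_chart_of_isProfiniteCompletion_at'
    S.chart
    (@id ((ofSpecialFibre X d S h36 Sigma SigmaHat hsub hne hprime hp TpH HatH hle cuspMeetsH).graph.Tp ≃ₜ*
      S.chart.G) (ContinuousMulEquiv.refl _)) S.hyp compactInVerticialAt_of_finiteGraph verticialInjective_holds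
    (ofSpecialFibre_graph_isProfiniteCompletion X d S h36 Sigma SigmaHat hsub hne hprime hp TpH HatH hle
      cuspMeetsH)
    Λv
    (fun v => by
      rw [ofSpecialFibre_graph_map_refl X d S h36 Sigma SigmaHat hsub hne hprime hp TpH HatH hle cuspMeetsH]
      exact hΛv v)
    src tgt c₁ c₂ hA3

end NodeData

/-! ### The forms BY NAME over a `PSCDatum` on `Π̂_𝔾` — (A3) is F-2540 `VerticialIntersectionNear` -/

section ByName

variable
  (G : PSCDatum (ofSpecialFibre X d S h36 Sigma SigmaHat hsub hne hprime hp TpH HatH hle cuspMeetsH).graph.Hat)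
  (hNN : G.VerticialIntersectionNear) (σ : S.Gc.graph.Vertex ≃ G.graph.V)
  (Λv : G.graph.V →
    Subgroup (ofSpecialFibre X d S h36 Sigma SigmaHat hsub hne hprime hp TpH HatH hle cuspMeetsH).graph.Tp)
  (hvert : ∀ v : S.Gc.graph.Vertex, Λv (σ v) ∈ verticialSubgroups S.chart v)
  (hΛv : ∀ v, (Λv v).map (ofSpecialFibre X d S h36 Sigma SigmaHat hsub hne hprime hp TpH HatH hle
    cuspMeetsH).graph.ι = G.vertGp v)
  (src tgt : G.graph.N → G.graph.V)
  (c₁ c₂ : G.graph.N →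
    (ofSpecialFibre X d S h36 Sigma SigmaHat hsub hne hprime hp TpH HatH hle cuspMeetsH).graph.Tp)
  (hends : ∀ e, G.graph.nodeEnds e = s(src e, tgt e))
  (h₁ : ∀ e, G.nodeGp e ≤
    MulAut.conj ((ofSpecialFibre X d S h36 Sigma SigmaHat hsub hne hprime hp TpH HatH hle
      cuspMeetsH).graph.ι (c₁ e)) • G.vertGp (src e))
  (h₂ : ∀ e, G.nodeGp e ≤
    MulAut.conj ((ofSpecialFibre X d S h36 Sigma SigmaHat hsub hne hprime hp TpH HatH hle
      cuspMeetsH).graph.ι (c₂ e)) • G.vertGp (tgt e))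
  (hloop : ∀ e, src e = tgt e → (c₁ e)⁻¹ * c₂ e ∉ Λv (src e))

include hNN hvert hΛv hends h₁ h₂ hloop in
/-- **F-2589 INSTANCE, every printed input BY NAME — [IUTchI] Prop. 2.1 AS TYPED at the genuine 𝔛-datum
with finite special fibre**: the verticial / nodal subgroups of a `PSCDatum` on `Π̂_𝔾` matched with a
verticial family of the chart, node data, and (A3) := the FROZEN FACT-LIST row F-2540
`PSCDatum.VerticialIntersectionNear` ([NodNon] Lem. 1.9 (ii) = "[AbsTopII] Prop. 1.3 (iv) or [NodNon]
Prop. 3.9 (i)" of the printed proof) BY NAME; [SemiAnbd] Thm. 3.7 (iii) / Galois domination are the kernel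
theorems `compactInVerticialAt_of_finiteGraph` / `galoisDomination_of_prop36 S.hyp.toProp36Hypotheses`.
([IUTchI] Prop 2.1 p.45) [cite: Mochizuki2012, Prop 2.1 p.45] [claim: Mochizuki2012, status: disputed] -/
theorem graph_prop21_byName_ofSpecialFibre_of_finiteGraph [Finite S.Gc.graph.Vertex]
    [Finite S.Gc.graph.Edge] :
    (ofSpecialFibre X d S h36 Sigma SigmaHat hsub hne hprime hp TpH HatH hle
      cuspMeetsH).graph.ProfiniteConjugatesOfCompactSubgroups :=
  (ofSpecialFibre X d S h36 Sigma SigmaHat hsub hne hprime hp TpH HatH hle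
      cuspMeetsH).graph.prop21_byName_at
    S.chart
    (@id ((ofSpecialFibre X d S h36 Sigma SigmaHat hsub hne hprime hp TpH HatH hle cuspMeetsH).graph.Tp ≃ₜ*
      S.chart.G) (ContinuousMulEquiv.refl _)) S.hyp compactInVerticialAt_of_finiteGraph
    (ofSpecialFibre_graph_isProfiniteCompletion X d S h36 Sigma SigmaHat hsub hne hprime hp TpH HatH hle
      cuspMeetsH)
    (galoisDomination_of_prop36 h36) G hNN σ Λv
    (fun v => by
      rw [ofSpecialFibre_graph_map_refl X d S h36 Sigma SigmaHat hsub hne hprime hp TpH HatH hle cuspMeetsH]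
      exact hvert v)
    hΛv src tgt c₁ c₂ hends h₁ h₂ hloop

include hNN hvert hΛv hends h₁ h₂ hloop in
/-- **F-2590, clause `tp_in_hat`, every printed input BY NAME — [IUTchI] Prop. 2.2 "in particular" at the
genuine 𝔛-datum with finite special fibre** ((A3) := F-2540 `VerticialIntersectionNear` BY NAME;
Thm. 3.7 (i)/(iii), Galois domination kernel theorems). ([IUTchI] Prop 2.2 p.45)
[cite: Mochizuki2012, Prop 2.2 p.45] [claim: Mochizuki2012, status: disputed] -/
theorem graph_prop22_inParticular_byName_ofSpecialFibre_of_finiteGraph [Finite S.Gc.graph.Vertex]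
    [Finite S.Gc.graph.Edge] :
    IsCommensurablyTerminal
      (ofSpecialFibre X d S h36 Sigma SigmaHat hsub hne hprime hp TpH HatH hle cuspMeetsH).graph.ι.range :=
  (ofSpecialFibre X d S h36 Sigma SigmaHat hsub hne hprime hp TpH HatH hle
      cuspMeetsH).graph.prop22_inParticular_byName_at
    S.chart
    (@id ((ofSpecialFibre X d S h36 Sigma SigmaHat hsub hne hprime hp TpH HatH hle cuspMeetsH).graph.Tp ≃ₜ*
      S.chart.G) (ContinuousMulEquiv.refl _)) S.hyp compactInVerticialAt_of_finiteGraph verticialInjective_holds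
    (ofSpecialFibre_graph_isProfiniteCompletion X d S h36 Sigma SigmaHat hsub hne hprime hp TpH HatH hle
      cuspMeetsH)
    (galoisDomination_of_prop36 h36) G hNN σ Λv
    (fun v => by
      rw [ofSpecialFibre_graph_map_refl X d S h36 Sigma SigmaHat hsub hne hprime hp TpH HatH hle cuspMeetsH]
      exact hvert v)
    hΛv src tgt c₁ c₂ hends h₁ h₂ hloop

include hNN hvert hΛv hends h₁ h₂ hloop in
/-- **F-2591 INSTANCE, every printed input BY NAME — [IUTchI] Rmk. 2.2.2 (`Π^tp_𝔾` normally terminal in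
`Π̂_𝔾`) at the genuine 𝔛-datum with finite special fibre**: the `TemperedNormallyTerminal` packaging of
`graph_prop22_inParticular_byName_ofSpecialFibre_of_finiteGraph` (commensurably ⇒ normally terminal,
abc-iut-L5-t1's `isNormallyTerminal`). ([IUTchI] Rmk 2.2.2 p.46) [cite: Mochizuki2012, Rmk 2.2.2 p.46]
[claim: Mochizuki2012, status: disputed] -/
theorem graph_temperedNormallyTerminal_byName_ofSpecialFibre_of_finiteGraph [Finite S.Gc.graph.Vertex]
    [Finite S.Gc.graph.Edge] :
    (ofSpecialFibre X d S h36 Sigma SigmaHat hsub hne hprime hp TpH HatH hle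
      cuspMeetsH).graph.TemperedNormallyTerminal :=
  ⟨fun _ => (graph_prop22_inParticular_byName_ofSpecialFibre_of_finiteGraph X d S h36 Sigma SigmaHat hsub
    hne hprime hp TpH HatH hle cuspMeetsH G hNN σ Λv hvert hΛv src tgt c₁ c₂ hends h₁ h₂
    hloop).isNormallyTerminal⟩

/-! ### F-2590 AS TYPED (the certificate's binder `h22`) — `𝔾`- and `ℍ`-inputs BY NAME, `hHatH` cited -/

include hNN hvert hΛv hends h₁ h₂ hloop in
/-- **F-2590 INSTANCE AS TYPED — [IUTchI] Prop. 2.2, all four commensurator clauses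
(`𝔇.graph.CommensuratorsOfDecompositionSubgroups`, the binder `h22` of `Conditional/Layer5OfS.layer5_held_sec2`)
at the genuine 𝔛-datum with finite special fibre**, from `prop22_byName_at` (pattern of abc-iut-L3-d1's
`prop22_byName_of_finiteGraph`):
[SemiAnbd] Thm. 3.7 (i)/(iii) and Galois domination are kernel theorems at `S.Gc` AND at the finite graph
`𝒢H` charting the `ℍ`-datum `𝔇.graph.restrictH hcH` ("we apply the notation introduced for `𝔾` to `ℍ`",
p. 44); (A3) at both := F-2540 BY NAME; `hHatH` = "`Π̂_ℍ` is commensurably terminal in `Π̂_𝔾`" ([SemiAnbd]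
Cor. 2.7 (i), pro-`Σ̂` form, p. 46 l. 9–12) cited; `[T2Space Π^tp_𝔾]` := `S.chart.isTempered.t2Space`.
([IUTchI] Prop 2.2 pp.45-46) [cite: Mochizuki2012, Prop 2.2 pp.45-46] [claim: Mochizuki2012, status: disputed] -/
theorem graph_prop22_byName_ofSpecialFibre_of_finiteGraph [Finite S.Gc.graph.Vertex] [Finite S.Gc.graph.Edge]
    {𝒢H : ProfiniteSemiGraph.{0}} [Finite 𝒢H.graph.Vertex] [Finite 𝒢H.graph.Edge]
    (hcH : IsClosed ((ofSpecialFibre X d S h36 Sigma SigmaHat hsub hne hprime hp TpH HatH hle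
      cuspMeetsH).graph.HatH :
        Set (ofSpecialFibre X d S h36 Sigma SigmaHat hsub hne hprime hp TpH HatH hle cuspMeetsH).graph.Hat))
    (cH : TemperedPiChart 𝒢H)
    (eH : ((ofSpecialFibre X d S h36 Sigma SigmaHat hsub hne hprime hp TpH HatH hle
      cuspMeetsH).graph.restrictH hcH).Tp ≃ₜ* cH.G)
    (h𝒢H : 𝒢H.Thm37Hypotheses)
    (hPCH : IsProfiniteCompletion
      ({ toMonoidHom := ((ofSpecialFibre X d S h36 Sigma SigmaHat hsub hne hprime hp TpH HatH hle
             cuspMeetsH).graph.restrictH hcH).ι,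
         continuous_toFun := ((ofSpecialFibre X d S h36 Sigma SigmaHat hsub hne hprime hp TpH HatH hle
             cuspMeetsH).graph.restrictH hcH).ι_continuous } :
        ((ofSpecialFibre X d S h36 Sigma SigmaHat hsub hne hprime hp TpH HatH hle
            cuspMeetsH).graph.restrictH hcH).Tp →ₜ*
          ((ofSpecialFibre X d S h36 Sigma SigmaHat hsub hne hprime hp TpH HatH hle
            cuspMeetsH).graph.restrictH hcH).Hat))
    (GH : PSCDatum ((ofSpecialFibre X d S h36 Sigma SigmaHat hsub hne hprime hp TpH HatH hle
      cuspMeetsH).graph.restrictH hcH).Hat)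
    (hNNH : GH.VerticialIntersectionNear) (σH : 𝒢H.graph.Vertex ≃ GH.graph.V)
    (ΛvH : GH.graph.V →
      Subgroup ((ofSpecialFibre X d S h36 Sigma SigmaHat hsub hne hprime hp TpH HatH hle
        cuspMeetsH).graph.restrictH hcH).Tp)
    (hvertH : ∀ v : 𝒢H.graph.Vertex,
      (ΛvH (σH v)).map
          (eH : ((ofSpecialFibre X d S h36 Sigma SigmaHat hsub hne hprime hp TpH HatH hle
            cuspMeetsH).graph.restrictH hcH).Tp →* cH.G) ∈ verticialSubgroups cH v)
    (hΛvH : ∀ v, (ΛvH v).map ((ofSpecialFibre X d S h36 Sigma SigmaHat hsub hne hprime hp TpH HatH hle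
      cuspMeetsH).graph.restrictH hcH).ι = GH.vertGp v)
    (srcH tgtH : GH.graph.N → GH.graph.V)
    (c₁H c₂H : GH.graph.N →
      ((ofSpecialFibre X d S h36 Sigma SigmaHat hsub hne hprime hp TpH HatH hle
        cuspMeetsH).graph.restrictH hcH).Tp)
    (hendsH : ∀ e, GH.graph.nodeEnds e = s(srcH e, tgtH e))
    (h₁H : ∀ e, GH.nodeGp e ≤
      MulAut.conj (((ofSpecialFibre X d S h36 Sigma SigmaHat hsub hne hprime hp TpH HatH hle
        cuspMeetsH).graph.restrictH hcH).ι (c₁H e)) • GH.vertGp (srcH e))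
    (h₂H : ∀ e, GH.nodeGp e ≤
      MulAut.conj (((ofSpecialFibre X d S h36 Sigma SigmaHat hsub hne hprime hp TpH HatH hle
        cuspMeetsH).graph.restrictH hcH).ι (c₂H e)) • GH.vertGp (tgtH e))
    (hloopH : ∀ e, srcH e = tgtH e → (c₁H e)⁻¹ * c₂H e ∉ ΛvH (srcH e))
    (hHatH : IsCommensurablyTerminal
      (ofSpecialFibre X d S h36 Sigma SigmaHat hsub hne hprime hp TpH HatH hle cuspMeetsH).graph.HatH) :
    (ofSpecialFibre X d S h36 Sigma SigmaHat hsub hne hprime hp TpH HatH hle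
      cuspMeetsH).graph.CommensuratorsOfDecompositionSubgroups :=
  haveI := ofSpecialFibre_graph_t2Space X d S h36 Sigma SigmaHat hsub hne hprime hp TpH HatH hle cuspMeetsH
  (ofSpecialFibre X d S h36 Sigma SigmaHat hsub hne hprime hp TpH HatH hle
      cuspMeetsH).graph.prop22_byName_at hcH
    S.chart
    (@id ((ofSpecialFibre X d S h36 Sigma SigmaHat hsub hne hprime hp TpH HatH hle cuspMeetsH).graph.Tp ≃ₜ*
      S.chart.G) (ContinuousMulEquiv.refl _)) S.hyp compactInVerticialAt_of_finiteGraph verticialInjective_holds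
    (ofSpecialFibre_graph_isProfiniteCompletion X d S h36 Sigma SigmaHat hsub hne hprime hp TpH HatH hle
      cuspMeetsH)
    (galoisDomination_of_prop36 h36) G hNN σ Λv
    (fun v => by
      rw [ofSpecialFibre_graph_map_refl X d S h36 Sigma SigmaHat hsub hne hprime hp TpH HatH hle cuspMeetsH]
      exact hvert v)
    hΛv src tgt c₁ c₂ hends h₁ h₂ hloop cH eH h𝒢H compactInVerticialAt_of_finiteGraph hPCH
    (galoisDomination_of_prop36 h𝒢H.toProp36Hypotheses) GH hNNH σH ΛvH hvertH hΛvH srcH tgtH c₁H c₂H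
    hendsH h₁H h₂H hloopH hHatH

end ByName

end StableCurveTemperedData

end Literature.IUT.HodgeTheaters

end
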